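import Summits.BirchSwinnertonDyer.Rank1Residual.Additive.FouquetWanLocus
import Literature.NumberTheory.EllipticCurves.Rank1Residual.Predicates
import HarnessLib

/-!
# primkoly — the conductor-type CELLS of X7 for the S1 promotion (ideator bsd-idea-14 g7; v1.1; NOTHING ASSERTED)

Companion to `Cruxes/AnticyclotomicEisensteinDivisibility/Ideas/primkoly.md` v2.3–v2.5 (§B7(iv), §B8).
Pure bookkeeping over the tree's census-decidable predicates: the partition of the X7 cell
(`ClassX7 W p` = good supersingular `p`, `E` not semistable) by the behaviour of `E` at its
MULTIPLICATIVE primes, and its position relative to the Fouquet–Wan locus `FWNonsplitRam W p`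
(on which the rung is already closed modulo one OPEN binder WITHOUT route SignedBaseChange:
`Rank1Residual/Supersingular/KobayashiMainConjectureX7FouquetWan.lean`).

* `CellAlpha`  — every bad prime is additive (no multiplicative prime at all);
* `CellBeta`   — some multiplicative prime, and `p ∤ v_q(Δ_min)` at EVERY multiplicative `q`
                 (`E[p]` ramified at every `q ∥ N`); sub-cells `CellBetaSplitOnly` (all of them split)
                 and the Fouquet–Wan part (`FWNonsplitRam`: some non-split one);
* `CellGamma`  — some multiplicative `q` with `p ∣ v_q(Δ_min)` (`E[p]` unramified at `q`; for split `q`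
                 this is `p ∣ c_q`, the Tamagawa-divisible cell).
* `BLVSixAt`   — Bertolini–Longo–Venerucci (Math. Ann. 2026) Hypothesis 1.1 (6) at a multiplicative
                 prime `q` with `p ∤ v_q(Δ_min)`, in its decomposition-group form
                 `H⁰(G_{ℚ_q}, E[p]) = 0`: split ⇒ `q ≢ 1 (mod p)`, non-split ⇒ `q ≢ −1 (mod p)`.
* `LiveLocus`  — `ClassX7 W p ∧ ¬ FWNonsplitRam W p`: where SignedBaseChange is actually needed.

Proved (logic only): the trichotomy `ClassX7 → α ∨ β ∨ γ`, `α → LiveLocus`, `β → FW ∨ β-split-only`,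
`β-split-only → LiveLocus`.

v1.1 (critic idea-crit-15 V#19 (A) P2′, 2026-08-28): the binder set of the ONE promoted research item,
`K1Binders W p := ClassX7 W p ∧ ¬ FWNonsplitRam W p ∧ (∀ q ∥ N, p ∤ v_q(Δ_min))`, the PROMOTION COVER
`ClassX7 → K1Binders ∨ (CellGamma ∧ ¬ FWNonsplitRam) ∨ FWNonsplitRam` (one research item, one
Tamagawa-divisible item, the Fouquet–Wan aside), and the identification `K1Binders ↔ α ∨ β-split-only`.
No statement about any `L`-function, Selmer group or curve class is made; BSD is not proved by this seat.
-/

set_option autoImplicit false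
set_option linter.dupNamespace false

namespace Summit.BirchSwinnertonDyer.BirchSwinnertonDyer.Cruxes.AnticyclotomicEisensteinDivisibility.PrimkolyCells

open WeierstrassCurve Literature.NumberTheory.EllipticCurves.Rank1Residual
  Summit.BirchSwinnertonDyer.Rank1Residual.Additive

variable (W : WeierstrassCurve ℚ) [W.IsGloballyMinimal] (p : ℕ) [Fact p.Prime]

/-- The live locus of route SignedBaseChange on X7: outside the Fouquet–Wan locus. A bookkeeping predicate; nothing asserted. [folklore] -/
def LiveLocus : Prop := ClassX7 W p ∧ ¬ FWNonsplitRam W p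

/-- Cell α: `E` has no prime of multiplicative reduction (on X7: all bad primes additive). [folklore] -/
def CellAlpha : Prop :=
  ClassX7 W p ∧ ∀ (q : ℕ) (_ : Fact q.Prime), ¬ W.HasMultiplicativeReductionAtPrime q

/-- Cell β: some multiplicative prime, and `E[p]` ramified at every multiplicative prime. [folklore] -/
def CellBeta : Prop :=
  ClassX7 W p ∧ (∃ (q : ℕ) (_ : Fact q.Prime), W.HasMultiplicativeReductionAtPrime q) ∧
    ∀ (q : ℕ) (_ : Fact q.Prime), W.HasMultiplicativeReductionAtPrime q →
      ¬ p ∣ padicValInt q W.minimalDiscriminantInt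

/-- Cell β, split-only part: as `CellBeta` and every multiplicative prime is split. [folklore] -/
def CellBetaSplitOnly : Prop :=
  CellBeta W p ∧ ∀ (q : ℕ) (_ : Fact q.Prime), W.HasMultiplicativeReductionAtPrime q →
    W.HasSplitMultiplicativeReductionAtPrime q

/-- Cell γ: some multiplicative prime `q` with `p ∣ v_q(Δ_min)` (`E[p]` unramified at `q`). [folklore] -/
def CellGamma : Prop :=
  ClassX7 W p ∧ ∃ (q : ℕ) (_ : Fact q.Prime), W.HasMultiplicativeReductionAtPrime q ∧
    p ∣ padicValInt q W.minimalDiscriminantInt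

/-- BLV Hypothesis 1.1 (6) at a multiplicative prime `q`, decomposition-group form, typed on the
arithmetic of `E` at `q`: `E[p]` ramified at `q` and `E(ℚ_q)[p] = 0` (Tate curve: split ⇒ `μ_p ⊄ ℚ_q`, non-split ⇒ `q ≢ −1`). A predicate; nothing asserted. [cite: BertoliniLongoVenerucci2026, Hypothesis 1.1 (6), revised (Math. Ann.) text] -/
def BLVSixAt (q : ℕ) [Fact q.Prime] : Prop :=
  ¬ p ∣ padicValInt q W.minimalDiscriminantInt ∧
    (W.HasSplitMultiplicativeReductionAtPrime q → ¬ q ≡ 1 [MOD p]) ∧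
    (¬ W.HasSplitMultiplicativeReductionAtPrime q → ¬ (q + 1) ≡ 0 [MOD p])

/-- Cell β₁ of the card: β with BLV (6) at every multiplicative prime. [folklore] -/
def CellBetaOne : Prop :=
  CellBeta W p ∧ ∀ (q : ℕ) (_ : Fact q.Prime), W.HasMultiplicativeReductionAtPrime q → BLVSixAt W p q

variable {W p}

/-- Trichotomy of X7 by the multiplicative primes. -/
theorem alpha_or_beta_or_gamma (hX : ClassX7 W p) :
    CellAlpha W p ∨ CellBeta W p ∨ CellGamma W p := by
  classical
  by_cases hγ : ∃ (q : ℕ) (_ : Fact q.Prime), W.HasMultiplicativeReductionAtPrime q ∧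
      p ∣ padicValInt q W.minimalDiscriminantInt
  · exact Or.inr (Or.inr ⟨hX, hγ⟩)
  · by_cases hβ : ∃ (q : ℕ) (_ : Fact q.Prime), W.HasMultiplicativeReductionAtPrime q
    · refine Or.inr (Or.inl ⟨hX, hβ, ?_⟩)
      intro q hq hmult hdvd
      exact hγ ⟨q, hq, hmult, hdvd⟩
    · refine Or.inl ⟨hX, ?_⟩
      intro q hq hmult
      exact hβ ⟨q, hq, hmult⟩

/-- On cell α there is no multiplicative prime, so the Fouquet–Wan hypothesis fails: α is live. -/
theorem liveLocus_of_cellAlpha (h : CellAlpha W p) : LiveLocus W p := by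
  refine ⟨h.1, ?_⟩
  rintro ⟨q, hq, -, hmult, -, -⟩
  exact h.2 q hq hmult

/-- On cell β either some multiplicative prime is non-split (then Fouquet–Wan applies) or all are split. -/
theorem fw_or_splitOnly_of_cellBeta (h : CellBeta W p) :
    FWNonsplitRam W p ∨ CellBetaSplitOnly W p := by
  classical
  by_cases hns : ∃ (q : ℕ) (_ : Fact q.Prime), W.HasMultiplicativeReductionAtPrime q ∧
      ¬ W.HasSplitMultiplicativeReductionAtPrime q
  · obtain ⟨q, hq, hmult, hnsplit⟩ := hns
    refine Or.inl ⟨q, hq, ?_, hmult, hnsplit, h.2.2 q hq hmult⟩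
    intro hqp
    -- `p` is a prime of good reduction on X7 (`GoodSS`), hence not multiplicative
    subst hqp
    exact not_hasGoodReductionAtPrime_of_hasMultiplicativeReductionAtPrime _ hmult h.1.1.1
  · refine Or.inr ⟨h, ?_⟩
    intro q hq hmult
    by_contra hsplit
    exact hns ⟨q, hq, hmult, hsplit⟩

/-- The split-only part of β is live (no non-split multiplicative prime). -/
theorem liveLocus_of_cellBetaSplitOnly (h : CellBetaSplitOnly W p) : LiveLocus W p := by
  refine ⟨h.1.1, ?_⟩
  rintro ⟨q, hq, -, hmult, hnsplit, -⟩
  exact hnsplit (h.2 q hq hmult)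

variable (W p) in
/-- v1.1 — the binder set of the ONE research item of the S1/C2 promotion (critic idea-crit-15 V#19 (A) P2′):
X7, outside the Fouquet–Wan locus, and `E[p]` ramified at every multiplicative prime (no Tamagawa-divisible
split prime). A bookkeeping predicate; nothing asserted. [folklore] -/
def K1Binders : Prop :=
  ClassX7 W p ∧ ¬ FWNonsplitRam W p ∧
    ∀ (q : ℕ) (_ : Fact q.Prime), W.HasMultiplicativeReductionAtPrime q →
      ¬ p ∣ padicValInt q W.minimalDiscriminantInt

/-- PROMOTION COVER of X7: every X7 pair lies in the research item's binder set, or in the live part of the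
Tamagawa-divisible cell γ, or on the Fouquet–Wan locus (booked elsewhere, modulo one OPEN binder). -/
theorem k1Binders_or_gammaLive_or_fw (hX : ClassX7 W p) :
    K1Binders W p ∨ (CellGamma W p ∧ ¬ FWNonsplitRam W p) ∨ FWNonsplitRam W p := by
  classical
  by_cases hfw : FWNonsplitRam W p
  · exact Or.inr (Or.inr hfw)
  · by_cases hγ : ∃ (q : ℕ) (_ : Fact q.Prime), W.HasMultiplicativeReductionAtPrime q ∧
        p ∣ padicValInt q W.minimalDiscriminantInt
    · exact Or.inr (Or.inl ⟨⟨hX, hγ⟩, hfw⟩)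
    · refine Or.inl ⟨hX, hfw, ?_⟩
      intro q hq hmult hdvd
      exact hγ ⟨q, hq, hmult, hdvd⟩

/-- The research item's binder set is live. -/
theorem liveLocus_of_k1Binders (h : K1Binders W p) : LiveLocus W p := ⟨h.1, h.2.1⟩

/-- The research item's binder set excludes the Tamagawa-divisible cell. -/
theorem not_cellGamma_of_k1Binders (h : K1Binders W p) : ¬ CellGamma W p := by
  rintro ⟨-, q, hq, hmult, hdvd⟩
  exact h.2.2 q hq hmult hdvd

/-- Identification, forward: the binder set is contained in α ∪ β-split-only. -/
theorem cellAlpha_or_cellBetaSplitOnly_of_k1Binders (h : K1Binders W p) :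
    CellAlpha W p ∨ CellBetaSplitOnly W p := by
  classical
  by_cases hβ : ∃ (q : ℕ) (_ : Fact q.Prime), W.HasMultiplicativeReductionAtPrime q
  · have hB : CellBeta W p := ⟨h.1, hβ, h.2.2⟩
    rcases fw_or_splitOnly_of_cellBeta hB with hfw | hsplit
    · exact absurd hfw h.2.1
    · exact Or.inr hsplit
  · refine Or.inl ⟨h.1, ?_⟩
    intro q hq hmult
    exact hβ ⟨q, hq, hmult⟩

/-- Identification, backward (α). -/
theorem k1Binders_of_cellAlpha (h : CellAlpha W p) : K1Binders W p := by
  refine ⟨h.1, (liveLocus_of_cellAlpha h).2, ?_⟩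
  intro q hq hmult
  exact absurd hmult (h.2 q hq)

/-- Identification, backward (β-split-only). -/
theorem k1Binders_of_cellBetaSplitOnly (h : CellBetaSplitOnly W p) : K1Binders W p :=
  ⟨h.1.1, (liveLocus_of_cellBetaSplitOnly h).2, h.1.2.2⟩

/-- Identification: `K1Binders ↔ α ∨ β-split-only`. -/
theorem k1Binders_iff_cellAlpha_or_cellBetaSplitOnly :
    K1Binders W p ↔ CellAlpha W p ∨ CellBetaSplitOnly W p :=
  ⟨cellAlpha_or_cellBetaSplitOnly_of_k1Binders,
    fun h => h.elim k1Binders_of_cellAlpha k1Binders_of_cellBetaSplitOnly⟩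

end Summit.BirchSwinnertonDyer.BirchSwinnertonDyer.Cruxes.AnticyclotomicEisensteinDivisibility.PrimkolyCells
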